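import Literature.NumberTheory.Sieve.AsymptoticSieveForPrimesS3Rough
import HarnessLib

/-!
# Asymptotic sieve for primes under (B*) with saving `(log x)^{-2^{22}}`: the estimate (8.5) of `S₃(x; y, Z)`

Topic `Literature/NumberTheory/Sieve` (trunk T-SIEVE), a sequel of `…S3Rough` in the programme of
`Literature.NumberTheory.Sieve.AsymptoticSieveForPrimesRoughWeak`. Source: J. Friedlander,
H. Iwaniec, *Asymptotic sieve for primes*, Ann. of Math. 148 (1998) 1041–1065
[FriedlanderIwaniecASP1998] (= arXiv:math/9811186), §8 (8.1)–(8.5) and §10 (Theorem 3, pp. 1063–1065).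

The tree's `fi_asp_S3_estimate_rough_holds` (`…S3Rough`) proves FI (8.5),
`|∫_Z^{eZ} S₃(x; y, z) dz/z| ≤ K A(x)/log x`, over the regime `FIRegimeRough` ((B*) with constant `1`,
saving `(log x)^{-2^{26}}`), consuming (B*) only through the reduced weighted bound
`∑_m 6^{ω(m)} |∑*_n γ μ a| ≤ K_B A(x)(log x)^{-5}` (`reduced_rough_bilinear_bound_six` at `k = 5`). This
file records the SAME proof with the regime unbundled (`fi_asp_S3_estimate_rough_of_reducedBound`:
the literal hypotheses of Theorem 1 with void bilinear parameters, the parameter clause (10.2) for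
`δ = (log x)^α`, `Δ_B = x^{2θ}`, the weights, and the reduced weighted bound as arguments), so that
(8.5) becomes available under (B*) with the printed saving `(log x)^{-2^{22}}` of Theorem 1
(`reduced_rough_bilinear_bound_six_of_le`, `…RoughWeak`), as needed for FI's Theorem 2 (§9:
arbitrary support, [FriedlanderIwaniecAnnals1998] Proposition 2.1; p. 1062 "we saved at least a
factor `log x` which is needed for clearing the implied constants"). The proof body is that of
`fi_asp_S3_estimate_rough_holds`, verbatim.

## References

* J. Friedlander, H. Iwaniec, *Asymptotic sieve for primes*, Ann. of Math. 148 (1998), 1041–1065,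
  §8 (8.5), §9 p. 1062 and §10 Theorem 3. [cite: FriedlanderIwaniecASP1998, §8 (8.5) and §10 Theorem 3]

## Mathlib / tree search

Everything used is in `…S3Rough` and its imports; `lean search 'S3_estimate_rough_of_reducedBound'`:
no declaration before this file.
-/

noncomputable section

open Filter Finset
open scoped ArithmeticFunction.Moebius ArithmeticFunction.vonMangoldt ArithmeticFunction.zeta

namespace Literature.NumberTheory.Sieve

open MeasureTheory
open scoped Topology

set_option maxHeartbeats 400000 in -- the pointwise assembly carries the ~40 local facts of `…S3Assembly` plus the `W₀/W₁` data; 2× the default budget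
/-- **FI (8.5) under (B*), regime unbundled**: for `α > 0`, `0 < θ₁ ≤ θ/2`, `θ < 1/6`, a sequence
with the literal hypotheses of Theorem 1 (void bilinear parameters), the parameter clause
`2 ≤ (log x)^α`, `2 ≤ x^{2θ}`, `2 ≤ P ≤ (x^{2θ})^{1/(2^{35} log log x)}` ((10.2)), upper-bound sieve weights
of sifting range `x^{θ₁}` and level `x^{θ/2}`, and the reduced sieved bilinear bound
`∑_m 6^{ω(m)} |∑_{N<n≤2N, mn≤x, (n,Π)=1} γ(n;C) μ(mn) a_{mn}| ≤ K_B A(x)(log x)^{-5}` for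
`x^{-2θ}√D < N < (log x)^{-α}√x`, `1 ≤ C ≤ x/D`: there is `K` with
`|S₃(x; y, Z)| = |∫_Z^{eZ} S₃(x; y, z) dz/z| ≤ K A(x)/log x` for all large `x`, every admissible
splitting parameter `s` and `Z ≤ y ≤ eZ` (`Z = x^{-θ/2}√D`). Proof: that of
`fi_asp_S3_estimate_rough_holds`. [cite: FriedlanderIwaniecASP1998, §8 (8.5) and §10 Theorem 3] -/
theorem fi_asp_S3_estimate_rough_of_reducedBound (A : SieveSequence) (D : ℝ → ℝ) (α θ θ₁ : ℝ)
    (lam : ℝ → ℕ → ℤ) (P : ℝ → ℝ) (hαpos : 0 < α) (hθ₁pos : 0 < θ₁) (hθ₁le' : θ₁ ≤ θ / 2)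
    (hθlt : θ < 1 / 6)
    (hhyp : A.FIAsymptoticSieveHypotheses D (fun x => 2 * Real.sqrt x) (fun _ => 2))
    (hparams : ∀ᶠ x : ℝ in atTop, 2 ≤ Real.log x ^ α ∧ 2 ≤ x ^ (2 * θ) ∧ 2 ≤ P x ∧
      P x ≤ (x ^ (2 * θ)) ^ (1 / (2 ^ 35 * Real.log (Real.log x))))
    (hweights : ∀ᶠ x : ℝ in atTop, IsUpperSieveWeights (x ^ θ₁) (x ^ (θ / 2)) (lam x))
    (hKBex : ∃ KB : ℝ, ∀ᶠ x : ℝ in atTop, ∀ N : ℝ, Real.sqrt (D x) / x ^ (2 * θ) < N →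
      N < Real.sqrt x / Real.log x ^ α → ∀ C : ℝ, 1 ≤ C → C ≤ x / D x →
        ∑ m ∈ Icc 1 ⌊x⌋₊, (6 : ℝ) ^ m.primeFactors.card *
          |∑ n ∈ (Ioc ⌊N⌋₊ ⌊2 * N⌋₊).filter
              (fun n : ℕ => ((m * n : ℕ) : ℝ) ≤ x ∧ ∀ p ∈ n.primeFactors, P x ≤ (p : ℝ)),
            (SieveSequence.fiGamma C n : ℝ) * (μ (m * n) : ℝ) * A.a (m * n)| ≤
          KB * A.size x / Real.log x ^ 5) :
    ∃ K : ℝ, ∀ᶠ x : ℝ in atTop, ∀ s : ℝ, IsFISplit D α θ x s →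
      ∀ y : ℝ, fiY D θ x ≤ y → y ≤ Real.exp 1 * fiY D θ x →
        |A.fiS3Z (lam x) s x y (fiY D θ x)| ≤ K * A.size x / Real.log x := by
  classical
  have hsize : ∀ t, A.size t = A.congrSum 1 t := hhyp.1
  have h116 : ∀ n : ℕ, ¬Squarefree n → A.a n = 0 := hhyp.2.2.2.2.2.1
  obtain ⟨K, hK⟩ := hhyp.2.2.2.1
  obtain ⟨c₉, K₉, h19⟩ := hhyp.2.2.2.2.1
  obtain ⟨K₂₄, h24'⟩ := fi_moebius_density_cancellation_holds A.density A.density_mult ⟨K, hK⟩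
    ⟨c₉, K₉, h19⟩
  obtain ⟨K_R, hR'⟩ := fi_reduced_remainder_bound_holds A D _ _ hhyp
  obtain ⟨KB, hKB⟩ := hKBex
  obtain ⟨K₆, h16c⟩ := hhyp.2.2.1
  have hg : A.density.IsMultiplicative := A.density_mult
  have hg0 : ∀ p : ℕ, p.Prime → 0 ≤ A.density p := fun p hp => (hK p hp).1
  have hθ₁ : 0 < θ₁ := hθ₁pos
  have hθ₁le : θ₁ ≤ θ / 2 := hθ₁le'
  have hθ : 0 < θ := by linarith
  have hθ6 : θ < 1 / 6 := hθlt
  have hθ3 : θ < 1 / 3 := by linarith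
  have hα : 0 < α := hαpos
  -- constants
  set K' := max K 0 with hK'
  set L2 := |K₉| / Real.log 2 ^ 10 with hL2
  set E₂ := Real.exp (2 * (|c₉| + L2) + 6 * K') with hE₂
  set E₁ := Real.exp (|c₉| + L2 + 3 * K') with hE₁
  set Kstar := E₂ * E₁ ^ 2 * (2 * |K₂₄|) * 4 ^ 6 with hKstar
  set KB' := max KB 0 with hKB'
  set KR' := max K_R 0 with hKR'
  have hKB'0 : 0 ≤ KB' := le_max_right _ _
  have hKR'0 : 0 ≤ KR' := le_max_right _ _
  have hKstar0 : 0 ≤ Kstar := by positivity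
  set C6 : ℝ := 2 ^ 18 * max K₆ 0 * Real.exp (2 ^ 28) with hC6
  have hC60 : 0 ≤ C6 := by positivity
  refine ⟨Kstar + 16 * KB' + 6 * KR' + 2 * C6, ?_⟩
  have hR1 : ∀ᶠ x : ℝ in atTop, x ^ (2 / 3 : ℝ) < D x ∧ D x < x :=
    hhyp.2.2.2.2.2.2.1.mono fun x hx => ⟨hx.1, hx.2.1⟩
  have hllev : ∀ᶠ x : ℝ in atTop, 0 < Real.log (Real.log x) :=
    ((Real.tendsto_log_atTop.comp Real.tendsto_log_atTop).eventually_gt_atTop 0).mono fun x hx => hx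
  filter_upwards [hweights, hKB, hR', hR1, eventually_exp_mul_fiY_le_sqrt hθ hR1,
    eventually_ge_atTop (16 : ℝ), eventually_ge_atTop (Real.exp 1),
    eventually_log_rpow_le_mul_rpow α (s := 1 / 4 - θ / 2) (c := 1 / 16) (by linarith) (by norm_num),
    (tendsto_rpow_atTop hθ₁).eventually_ge_atTop (2 : ℝ), h16c, hparams, hllev]
    with x hw hBx hRx hR1x heY hx16 hxe h16 hP2 h16x hparx hll
  intro s hs y hYy hyY
  -- basic facts at `x`
  have he1 : (1 : ℝ) ≤ Real.exp 1 := by linarith [Real.add_one_le_exp (1 : ℝ)]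
  have hx1 : 1 ≤ x := by linarith only [he1, hxe]
  have hx1' : 1 < x := by linarith only [hx16]
  have hx0 : 0 < x := by linarith only [hx1]
  have hlogx : 1 ≤ Real.log x := by rw [Real.le_log_iff_exp_le hx0]; exact hxe
  have hlogx0 : 0 < Real.log x := by linarith only [hlogx]
  have hD0 : 0 < D x := lt_trans (by positivity) hR1x.1
  have hDx : D x < x := hR1x.2
  have hD1 : 1 ≤ D x := le_trans (Real.one_le_rpow hx1 (by norm_num)) hR1x.1.le
  have hA0 : 0 ≤ A.size x := by rw [hsize]; exact A.congrSum_nonneg 1 x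
  obtain ⟨δ, hδ⟩ : ∃ δ : ℝ, δ = Real.log x ^ α := ⟨_, rfl⟩
  have hδ1 : 1 ≤ δ := by rw [hδ]; exact Real.one_le_rpow hlogx hα.le
  have hδ0 : 0 < δ := by linarith only [hδ1]
  have hlα0 : 0 < Real.log x ^ α := Real.rpow_pos_of_pos hlogx0 α
  obtain ⟨Lw, hLw⟩ : ∃ Lw : ℝ, Lw = x ^ (θ / 2) := ⟨_, rfl⟩
  rw [← hLw] at hw
  set Pw := x ^ θ₁ with hPw
  have hxθ0 : 0 < x ^ (θ / 2) := Real.rpow_pos_of_pos hx0 _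
  have hLw0 : 0 < Lw := by rw [hLw]; exact hxθ0
  have hLw1 : 1 ≤ Lw := by rw [hLw]; exact Real.one_le_rpow hx1 (by linarith only [hθ])
  have hP0 : 0 < Pw := Real.rpow_pos_of_pos hx0 _
  have hsqrt0 : 0 < Real.sqrt x := Real.sqrt_pos.mpr hx0
  set X := ⌊x⌋₊ with hXdef
  have hX2 : 2 ≤ X := Nat.le_floor (by push_cast; linarith only [hx16])
  have hlogX : Real.log X ≤ Real.log x :=
    Real.log_le_log (by exact_mod_cast (show 0 < X by omega)) (Nat.floor_le hx0.le)
  have hlogX0 : 0 ≤ Real.log X := Real.log_nonneg (by exact_mod_cast (show 1 ≤ X by omega))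
  -- `Y`, `u₀`, `s`
  set Y := fiY D θ x with hYdef
  obtain ⟨hY0, hYP⟩ := fiY_pos_and_ge (D := D) (θ := θ) (θ₁ := θ₁) hx1 hR1x.1 (by linarith only [hθ₁le, hθ3])
  obtain ⟨u₀, hu₀⟩ : ∃ u₀ : ℝ, u₀ = Real.sqrt x / (8 * δ) := ⟨_, rfl⟩
  have hu₀0 : 0 < u₀ := by rw [hu₀]; exact div_pos hsqrt0 (mul_pos (by norm_num) hδ0)
  have hSY : fiSLow D α θ x * Y = u₀ := by
    rw [hu₀, hδ]
    show fiSLow D α θ x * fiY D θ x = Real.sqrt x / (8 * Real.log x ^ α)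
    have hb : 8 * Real.log x ^ α * Real.sqrt (D x) * x ^ (θ / 2) ≠ 0 :=
      mul_ne_zero (mul_ne_zero (mul_ne_zero (by norm_num) hlα0.ne') (Real.sqrt_pos.mpr hD0).ne')
        hxθ0.ne'
    have hd : (8 * Real.log x ^ α) ≠ 0 := mul_ne_zero (by norm_num) hlα0.ne'
    rw [fiSLow, fiY, div_mul_div_comm, div_eq_div_iff hb hd]
    ring
  have hfS0 : 0 < fiSLow D α θ x := by
    unfold fiSLow
    exact div_pos (mul_pos hxθ0 hsqrt0) (mul_pos (mul_pos (by norm_num) hlα0) (Real.sqrt_pos.mpr hD0))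
  obtain ⟨⟨k₀, rfl⟩, hslow, hsup⟩ := hs
  have hs0 : (0 : ℝ) < 2 ^ k₀ := by positivity
  have hsy_gt : u₀ < 2 ^ k₀ * y := by
    calc u₀ = fiSLow D α θ x * Y := hSY.symm
      _ < 2 ^ k₀ * Y := mul_lt_mul_of_pos_right hslow hY0
      _ ≤ 2 ^ k₀ * y := mul_le_mul_of_nonneg_left hYy hs0.le
  have hsy0 : 0 ≤ 2 ^ k₀ * y := by linarith only [hu₀0, hsy_gt]
  have hfiSLow_le : fiSLow D α θ x ≤ x ^ 2 / 8 := by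
    unfold fiSLow
    rw [div_le_div_iff₀ (by positivity) (by norm_num : (0 : ℝ) < 8)]
    have hLwx : x ^ (θ / 2) ≤ x := by
      calc x ^ (θ / 2) ≤ x ^ (1 : ℝ) := Real.rpow_le_rpow_of_exponent_le hx1 (by linarith only [hθ, hθ3])
        _ = x := Real.rpow_one x
    have h2 : Real.sqrt x ≤ x := Real.sqrt_le_self_iff.mpr (Or.inr hx1)
    have h4 : 1 ≤ Real.sqrt (D x) := Real.one_le_sqrt.mpr hD1
    have hlα1 : 1 ≤ Real.log x ^ α := Real.one_le_rpow hlogx hα.le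
    have h5 : x ^ (θ / 2) * Real.sqrt x ≤ x * x := mul_le_mul hLwx h2 hsqrt0.le hx0.le
    calc x ^ (θ / 2) * Real.sqrt x * 8 ≤ x * x * (8 * 1 * 1) := by linarith only [h5]
      _ ≤ x * x * (8 * Real.log x ^ α * Real.sqrt (D x)) := by
          refine mul_le_mul_of_nonneg_left ?_ (mul_nonneg hx0.le hx0.le)
          exact mul_le_mul (mul_le_mul_of_nonneg_left hlα1 (by norm_num)) h4 zero_le_one
            (mul_nonneg (by norm_num) hlα0.le)
      _ = x ^ 2 * (8 * Real.log x ^ α * Real.sqrt (D x)) := by rw [sq]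
  have hk₀ : (k₀ : ℝ) ≤ 4 * Real.log x := by
    refine nat_le_four_mul_log_of_two_pow_le ?_
    have hx2 : 0 ≤ x ^ 2 := sq_nonneg x
    linarith only [hsup, hfiSLow_le, hx2]
  -- `C₀ = ⌈x/D⌉`, `Dn = ⌊D⌋`
  set C₀ := ⌈x / D x⌉₊ with hC₀
  have hxD0 : 0 < x / D x := div_pos hx0 hD0
  have hC1 : 1 ≤ C₀ := Nat.one_le_iff_ne_zero.mpr (Nat.pos_iff_ne_zero.mp (Nat.ceil_pos.mpr hxD0))
  have hC₀le : (C₀ : ℝ) < x / D x + 1 := Nat.ceil_lt_add_one hxD0.le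
  have hC₀ge : x / D x ≤ C₀ := Nat.le_ceil _
  have hlogC₀ : Real.log C₀ ≤ 2 * Real.log x := by
    have h1 : (C₀ : ℝ) ≤ 2 * x := by
      have : x / D x ≤ x := div_le_self hx0.le hD1
      linarith only [this, hC₀le, hx1]
    have h2 : Real.log C₀ ≤ Real.log (2 * x) := Real.log_le_log (by exact_mod_cast hC1) h1
    rw [Real.log_mul (by norm_num) hx0.ne'] at h2
    have h3 : Real.log 2 ≤ Real.log x := Real.log_le_log (by norm_num) (by linarith only [hx16])
    linarith only [h2, h3]
  set Dn := ⌊D x⌋₊ with hDn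
  have hDn1 : 1 ≤ Dn := Nat.le_floor (by exact_mod_cast hD1)
  have hDfl : (Dn : ℝ) ≤ D x := Nat.floor_le hD0.le
  have hlogDn : Real.log Dn ≤ Real.log x :=
    Real.log_le_log (by exact_mod_cast hDn1) (hDfl.trans hDx.le)
  have hDcond : ∀ d : ℕ, ((d * C₀ : ℕ) : ℝ) < x → d ≤ Dn := by
    intro d hd
    refine Nat.le_floor ?_
    have hC₀0 : (0 : ℝ) < C₀ := by exact_mod_cast hC1
    push_cast at hd
    have h1 : (d : ℝ) < x / C₀ := by rw [lt_div_iff₀ hC₀0]; exact hd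
    have h2 : x / C₀ ≤ D x := by
      rw [div_le_iff₀ hC₀0]
      calc x = x / D x * D x := by field_simp
        _ ≤ C₀ * D x := mul_le_mul_of_nonneg_right hC₀ge hD0.le
        _ = D x * C₀ := mul_comm _ _
    linarith only [h1, h2]
  -- `a₀ = ⌊sy/Lw⌋ ≥ x^{1/4}`
  obtain ⟨a₀, ha₀⟩ : ∃ a₀ : ℕ, a₀ = ⌊2 ^ k₀ * y / Lw⌋₊ := ⟨_, rfl⟩
  have hx14 : (2 : ℝ) ≤ x ^ (1 / 4 : ℝ) := by
    have h44 : ((4 : ℕ) : ℝ)⁻¹ = (1 / 4 : ℝ) := by norm_num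
    have h2 : ((2 : ℝ) ^ (4 : ℕ)) ^ (1 / 4 : ℝ) = 2 := by
      rw [← h44]; exact Real.pow_rpow_inv_natCast zero_le_two four_ne_zero
    have h16x : (2 : ℝ) ^ (4 : ℕ) ≤ x := le_trans (by norm_num) hx16
    have h3 : ((2 : ℝ) ^ (4 : ℕ)) ^ (1 / 4 : ℝ) ≤ x ^ (1 / 4 : ℝ) :=
      Real.rpow_le_rpow (pow_nonneg zero_le_two 4) h16x (by norm_num)
    rw [h2] at h3
    exact h3
  have ha₀ge : x ^ (1 / 4 : ℝ) ≤ a₀ := by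
    -- `sy/Lw > u₀/Lw = x^{1/2-θ/2}/(8δ) ≥ 2 x^{1/4} ≥ x^{1/4} + 1`
    have h1 : u₀ / Lw ≤ 2 ^ k₀ * y / Lw := div_le_div_of_nonneg_right hsy_gt.le hLw0.le
    have h2 : x ^ (1 / 4 : ℝ) + 1 ≤ u₀ / Lw := by
      rw [hu₀, hLw, div_div, le_div_iff₀ (mul_pos (mul_pos (by norm_num) hδ0) hxθ0)]
      have hx14' : (1 : ℝ) ≤ x ^ (1 / 4 : ℝ) := by linarith only [hx14]
      have hsplit : Real.sqrt x = x ^ (1 / 4 : ℝ) * (x ^ (1 / 4 - θ / 2 : ℝ) * x ^ (θ / 2)) := by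
        rw [← Real.rpow_add hx0, ← Real.rpow_add hx0, Real.sqrt_eq_rpow]; norm_num
      rw [hsplit]
      have h3 : (x ^ (1 / 4 : ℝ) + 1) * (8 * δ * x ^ (θ / 2)) ≤ (2 * x ^ (1 / 4 : ℝ)) * (8 * δ * x ^ (θ / 2)) :=
        mul_le_mul_of_nonneg_right (by linarith only [hx14']) (mul_pos (mul_pos (by norm_num) hδ0) hxθ0).le
      refine h3.trans ?_
      have h4 : 16 * δ ≤ x ^ (1 / 4 - θ / 2 : ℝ) := by rw [hδ]; linarith only [h16]
      calc 2 * x ^ (1 / 4 : ℝ) * (8 * δ * x ^ (θ / 2)) = x ^ (1 / 4 : ℝ) * ((16 * δ) * x ^ (θ / 2)) := by ring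
        _ ≤ x ^ (1 / 4 : ℝ) * (x ^ (1 / 4 - θ / 2 : ℝ) * x ^ (θ / 2)) :=
            mul_le_mul_of_nonneg_left (mul_le_mul_of_nonneg_right h4 hxθ0.le) (Real.rpow_nonneg hx0.le _)
    have h3 : x ^ (1 / 4 : ℝ) + 1 ≤ 2 ^ k₀ * y / Lw := h2.trans h1
    have h4 : 2 ^ k₀ * y / Lw - 1 < (⌊2 ^ k₀ * y / Lw⌋₊ : ℝ) := Nat.sub_one_lt_floor _
    rw [← ha₀] at h4
    generalize x ^ (1 / 4 : ℝ) = q at h3 ⊢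
    generalize 2 ^ k₀ * y / Lw = r at h3 h4 ⊢
    linarith only [h3, h4]
  have ha₀2 : 2 ≤ a₀ := by
    have h2 : ((2 : ℕ) : ℝ) ≤ (a₀ : ℝ) := by rw [Nat.cast_ofNat]; exact hx14.trans ha₀ge
    exact Nat.cast_le.mp h2
  have hloga₀ : Real.log x / 4 ≤ Real.log a₀ := by
    have := Real.log_le_log (Real.rpow_pos_of_pos hx0 _) ha₀ge
    rwa [Real.log_rpow hx0, show (1 / 4 : ℝ) * Real.log x = Real.log x / 4 by ring] at this
  have ha₀le : ∀ ν : ℕ, 1 ≤ ν → (ν : ℝ) ≤ Lw → a₀ ≤ ⌊2 ^ k₀ * y / ν⌋₊ := by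
    intro ν hν hνL
    rw [ha₀]
    refine Nat.floor_le_floor ?_
    exact div_le_div_of_nonneg_left hsy0 (by exact_mod_cast hν) hνL
  -- the analytic sums
  have hBe : ∑ e ∈ (Icc 1 X).filter Squarefree, A.density e * (e.divisors.card : ℝ) * sigmaHalf e ≤
      E₂ * Real.log x ^ 2 :=
    (sum_squarefree_density_card_sigmaHalf_le hg hK h19 hX2).trans
      (mul_le_mul_of_nonneg_left (pow_le_pow_left₀ hlogX0 hlogX 2) (Real.exp_pos _).le)
  have hSgs : ∑ ν ∈ (Icc 1 X).filter Squarefree, A.density ν * sigmaHalf ν ≤ E₁ * Real.log x :=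
    (sum_squarefree_density_sigmaHalf_le hg hK h19 hX2).trans
      (mul_le_mul_of_nonneg_left hlogX (Real.exp_pos _).le)
  have hSgs0 : 0 ≤ ∑ ν ∈ (Icc 1 X).filter Squarefree, A.density ν * sigmaHalf ν :=
    Finset.sum_nonneg fun ν hν => mul_nonneg
      (ArithmeticFunction.IsMultiplicative.nonneg_of_squarefree hg hg0 (Finset.mem_filter.mp hν).2)
      (le_trans zero_le_one (one_le_sigmaHalf ν))
  -- (R′) at `x`, with a nonnegative constant
  set R := KR' * A.size x / Real.log x ^ 3 with hRdef
  have hl3 : 0 < Real.log x ^ 3 := pow_pos hlogx0 3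
  have hl5 : 0 < Real.log x ^ 5 := pow_pos hlogx0 5
  have hR0 : 0 ≤ R := div_nonneg (mul_nonneg hKR'0 hA0) hl3.le
  have hRx' : ∀ t : ℝ, t ≤ x →
      ∑ d ∈ (Icc 1 Dn).filter Squarefree, (divisorCountK 5 d : ℝ) * |A.remainder d t| ≤ R := by
    intro t ht
    refine (hRx t ht).trans ?_
    exact div_le_div_of_nonneg_right (mul_le_mul_of_nonneg_right (le_max_left _ _) hA0) hl3.le
  -- the reduced sieved bilinear bound on the dyadic pieces, for `u ∈ (Y/Lw, eY)` and `q < C₀`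
  set KBx := KB' * A.size x / Real.log x ^ 5 with hKBx
  have hKBx0 : 0 ≤ KBx := div_nonneg (mul_nonneg hKB'0 hA0) hl5.le
  have hB6' : ∀ u ∈ Set.Ioo (Y / Lw) (Real.exp 1 * Y), ∀ q ∈ Ico 1 C₀, ∀ i ∈ range k₀,
      ∑ m ∈ Icc 1 ⌊x⌋₊, (6 : ℝ) ^ m.primeFactors.card *
        |∑ n ∈ (Ioc ⌊2 ^ i * u⌋₊ ⌊2 * (2 ^ i * u)⌋₊).filter
            (fun n : ℕ => ((m * n : ℕ) : ℝ) ≤ x ∧ ∀ p ∈ n.primeFactors, P x ≤ (p : ℝ)),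
          (SieveSequence.fiGamma (q : ℝ) n : ℝ) * (μ (m * n) : ℝ) * A.a (m * n)| ≤ KBx := by
    intro u hu q hq i hi
    have hi' : i < k₀ := Finset.mem_range.mp hi
    have hu0 : 0 < u := lt_trans (div_pos hY0 hLw0) hu.1
    have hN1 : Real.sqrt (D x) / x ^ (2 * θ) < 2 ^ i * u := by
      have hle : Real.sqrt (D x) / x ^ (2 * θ) ≤ Y / Lw := by
        rw [hLw]
        show Real.sqrt (D x) / x ^ (2 * θ) ≤ Real.sqrt (D x) / x ^ (θ / 2) / x ^ (θ / 2)
        rw [div_div, ← Real.rpow_add hx0, add_halves]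
        refine div_le_div_of_nonneg_left (Real.sqrt_nonneg _) (Real.rpow_pos_of_pos hx0 _) ?_
        exact Real.rpow_le_rpow_of_exponent_le hx1 (by linarith only [hθ])
      calc Real.sqrt (D x) / x ^ (2 * θ) ≤ Y / Lw := hle
        _ < u := hu.1
        _ ≤ 2 ^ i * u := le_mul_of_one_le_left hu0.le (one_le_pow₀ one_le_two)
    have h2i : (2 : ℝ) ^ i ≤ 2 ^ k₀ / 2 := by
      rw [le_div_iff₀ two_pos, ← pow_succ]
      exact pow_le_pow_right₀ one_le_two (Nat.succ_le_of_lt hi')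
    have he8 : Real.exp 1 / 8 < 1 :=
      (div_lt_one (by norm_num : (0 : ℝ) < 8)).mpr (Real.exp_one_lt_d9.trans (by norm_num))
    have heY0 : 0 ≤ Real.exp 1 * Y := mul_nonneg (Real.exp_pos 1).le hY0.le
    have hq' : 0 < Real.sqrt x / δ := div_pos hsqrt0 hδ0
    have hN2 : 2 ^ i * u < Real.sqrt x / δ := by
      have hfe : fiSLow D α θ x * (Real.exp 1 * Y) = (Real.exp 1 / 8) * (Real.sqrt x / δ) := by
        calc fiSLow D α θ x * (Real.exp 1 * Y) = Real.exp 1 * (fiSLow D α θ x * Y) := by ring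
          _ = Real.exp 1 * u₀ := by rw [hSY]
          _ = (Real.exp 1 / 8) * (Real.sqrt x / δ) := by rw [hu₀]; ring
      calc 2 ^ i * u ≤ (2 ^ k₀ / 2) * (Real.exp 1 * Y) := mul_le_mul h2i hu.2.le hu0.le (div_nonneg hs0.le two_pos.le)
        _ ≤ fiSLow D α θ x * (Real.exp 1 * Y) :=
            mul_le_mul_of_nonneg_right (by linarith only [hsup]) heY0
        _ = (Real.exp 1 / 8) * (Real.sqrt x / δ) := hfe
        _ < 1 * (Real.sqrt x / δ) := mul_lt_mul_of_pos_right he8 hq'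
        _ = Real.sqrt x / δ := one_mul _
    rw [hδ] at hN2
    have hq1 : (1 : ℝ) ≤ q := by exact_mod_cast (Finset.mem_Ico.mp hq).1
    have hqC : (q : ℝ) ≤ x / D x := by
      have hqlt : q + 1 ≤ C₀ := (Finset.mem_Ico.mp hq).2
      have : (q : ℝ) + 1 ≤ C₀ := by exact_mod_cast hqlt
      linarith only [this, hC₀le]
    have h0 := hBx (2 ^ i * u) hN1 hN2 q hq1 hqC
    refine h0.trans ?_
    exact div_le_div_of_nonneg_right (mul_le_mul_of_nonneg_right (le_max_left _ _) hA0) hl5.le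
  -- `W₁`: Rankin's saving under (10.2) and the sixth moment
  have hPx1 : 1 < P x := by linarith only [hparx.2.2.1]
  set E1 : ℝ := 2 * C6 * A.size x / Real.log x ^ 6 with hE1
  have hE10 : 0 ≤ E1 := by positivity
  have hW1 : Real.log C₀ * ((Lw ^ (-(1 / Real.log (P x)))) *
      ∑ n ∈ Ioc 0 ⌊x⌋₊, A.a n * ((n.divisors.card : ℝ)) ^ 6) ≤ E1 := by
    have hx8 : (8 : ℝ) ≤ x := by linarith only [hx16]
    have hmom := hhyp.sum_a_mul_card_divisors_pow_six_le hx8 h16x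
    have hrank : Lw ^ (-(1 / Real.log (P x))) ≤ Real.log x ^ (-(2 ^ 33 : ℝ)) := by
      rw [hLw]; exact rankin_rpow_le_log_rpow hx1' hll hθ hparx.2.2.1 hparx.2.2.2
    have hrank0 : 0 ≤ Lw ^ (-(1 / Real.log (P x))) := Real.rpow_nonneg hLw0.le _
    have hmom0 : 0 ≤ ∑ n ∈ Ioc 0 ⌊x⌋₊, A.a n * ((n.divisors.card : ℝ)) ^ 6 :=
      Finset.sum_nonneg fun n _ => mul_nonneg (A.a_nonneg n) (by positivity)
    have hpow : Real.log x ^ (-(2 ^ 33 : ℝ)) * Real.log x ^ (2 ^ 26 : ℝ) ≤ (Real.log x ^ 7)⁻¹ := by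
      have h7 : (Real.log x ^ 7)⁻¹ = Real.log x ^ (-(7 : ℝ)) := by
        rw [Real.rpow_neg hlogx0.le, show (7 : ℝ) = ((7 : ℕ) : ℝ) by norm_num, Real.rpow_natCast]
      rw [h7, ← Real.rpow_add hlogx0]
      exact Real.rpow_le_rpow_of_exponent_le hlogx (by norm_num)
    calc Real.log C₀ * ((Lw ^ (-(1 / Real.log (P x)))) *
          ∑ n ∈ Ioc 0 ⌊x⌋₊, A.a n * ((n.divisors.card : ℝ)) ^ 6)
        ≤ (2 * Real.log x) * (Real.log x ^ (-(2 ^ 33 : ℝ)) * (C6 * A.size x * Real.log x ^ (2 ^ 26 : ℝ))) := by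
          refine mul_le_mul hlogC₀ (mul_le_mul hrank hmom hmom0 (Real.rpow_nonneg hlogx0.le _))
            (mul_nonneg hrank0 hmom0) (by positivity)
      _ = 2 * C6 * A.size x * Real.log x * (Real.log x ^ (-(2 ^ 33 : ℝ)) * Real.log x ^ (2 ^ 26 : ℝ)) := by ring
      _ ≤ 2 * C6 * A.size x * Real.log x * (Real.log x ^ 7)⁻¹ :=
          mul_le_mul_of_nonneg_left hpow (by positivity)
      _ = E1 := by rw [hE1]; field_simp
  -- the pointwise bound for `z ∈ (Y, eY]`
  set B₀ := Kstar * A.size x / Real.log x + 2 * R * Real.log x + E1 with hB₀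
  -- `W₀(z)`: the part of the `λ⁻`-sum with a small smooth variable, to be integrated over `z`
  set W0f : ℝ → ℝ := fun z => ∑ k ∈ Icc 1 ⌊x⌋₊, ((k.divisors.card : ℝ)) ^ 2 *
      ∑ n₁ ∈ (Icc 1 (⌊x⌋₊ / k)).filter (fun n : ℕ => Squarefree n ∧
          (∀ p ∈ n.primeFactors, (p : ℝ) < P x) ∧ (n : ℝ) ≤ Lw),
        (n₁.divisors.card : ℝ) * ∑ q ∈ Ico 1 C₀, Real.log (((q : ℝ) + 1) / q) *
          |∑ n₀ ∈ (Icc 1 (⌊x⌋₊ / (k * n₁))).filter (fun n : ℕ => ∀ p ∈ n.primeFactors, P x ≤ (p : ℝ)),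
            (if z / n₁ < (n₀ : ℝ) ∧ (n₀ : ℝ) ≤ 2 ^ k₀ * (z / n₁) then
              (SieveSequence.fiGamma (q : ℝ) n₀ : ℝ) * (μ n₀ : ℝ) * A.a (k * n₁ * n₀) else 0)| with hW0f
  have hW0f0 : ∀ z, 0 ≤ W0f z := fun z =>
    Finset.sum_nonneg fun k _ => mul_nonneg (by positivity) (Finset.sum_nonneg fun n₁ _ =>
      mul_nonneg (Nat.cast_nonneg _) (Finset.sum_nonneg fun q hq =>
        mul_nonneg (log_succ_div_nonneg (Finset.mem_Ico.mp hq).1) (abs_nonneg _)))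
  set Gf : ℝ → ℝ → ℝ := fun c z => ∑ d ∈ (Icc 1 Dn).filter Squarefree, ∑ k ∈ d.divisors,
      ((k.divisors.card : ℝ)) ^ 2 * |A.remainder d (min (c * ((k : ℝ) * z)) x)| with hGf
  have hGf0 : ∀ c z, 0 ≤ Gf c z := fun c z =>
    Finset.sum_nonneg fun d _ => Finset.sum_nonneg fun k _ => mul_nonneg (pow_nonneg (Nat.cast_nonneg _) 2) (abs_nonneg _)
  have hptw : ∀ z ∈ Set.Ioc Y (Real.exp 1 * Y),
      |A.fiS3 (lam x) (2 ^ k₀) x y z| ≤ B₀ + Real.log x * (Gf 1 z + Gf (2 ^ k₀) z) + W0f z := by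
    intro z hz
    have hz0 : 0 < z := hY0.trans hz.1
    have hz1 : 1 ≤ z := le_trans (le_trans (Real.one_le_rpow hx1 hθ₁.le) hYP) hz.1.le
    have hPz : Pw ≤ z := hYP.trans hz.1.le
    have h3 := A.abs_fiS3_le_three h116 hw hPz hz1 hx0.le hC1 (s := 2 ^ k₀) (y := y)
    -- `S*`
    have hstar := A.abs_S3star_le hsize hg0 h24' hw hC1 hx1 hz0 hsy0 ha₀2 ha₀le
    have hstar' : A.size x * ((∑ e ∈ (Icc 1 X).filter Squarefree,
        A.density e * (e.divisors.card : ℝ) * sigmaHalf e) *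
        (∑ ℓ ∈ (Icc 1 X).filter Squarefree, A.density ℓ * sigmaHalf ℓ) *
        (2 * |K₂₄| * Real.log x / Real.log a₀ ^ 6) *
        ∑ ν ∈ (Icc 1 X).filter Squarefree, A.density ν * sigmaHalf ν) ≤ Kstar * A.size x / Real.log x := by
      have hl4 : 0 < Real.log x / 4 := div_pos hlogx0 four_pos
      have hloga₀0 : 0 < Real.log a₀ := lt_of_lt_of_le hl4 hloga₀
      have h2K : 0 ≤ 2 * |K₂₄| * Real.log x := mul_nonneg (mul_nonneg two_pos.le (abs_nonneg _)) hlogx0.le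
      have hCst : 2 * |K₂₄| * Real.log x / Real.log a₀ ^ 6 ≤ 2 * |K₂₄| * Real.log x / (Real.log x / 4) ^ 6 :=
        div_le_div_of_nonneg_left h2K (pow_pos hl4 6) (pow_le_pow_left₀ hl4.le hloga₀ 6)
      have hCst0 : 0 ≤ 2 * |K₂₄| * Real.log x / Real.log a₀ ^ 6 := div_nonneg h2K (pow_pos hloga₀0 6).le
      calc A.size x * ((∑ e ∈ (Icc 1 X).filter Squarefree,
            A.density e * (e.divisors.card : ℝ) * sigmaHalf e) *
            (∑ ℓ ∈ (Icc 1 X).filter Squarefree, A.density ℓ * sigmaHalf ℓ) *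
            (2 * |K₂₄| * Real.log x / Real.log a₀ ^ 6) *
            ∑ ν ∈ (Icc 1 X).filter Squarefree, A.density ν * sigmaHalf ν)
          ≤ A.size x * ((E₂ * Real.log x ^ 2) * (E₁ * Real.log x) *
            (2 * |K₂₄| * Real.log x / (Real.log x / 4) ^ 6) * (E₁ * Real.log x)) := by
            refine mul_le_mul_of_nonneg_left ?_ hA0
            refine mul_le_mul (mul_le_mul (mul_le_mul hBe hSgs hSgs0 (by positivity)) hCst hCst0
              (by positivity)) hSgs hSgs0 (by positivity)
        _ = Kstar * A.size x / Real.log x := by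
            rw [hKstar]
            field_simp
    -- `S'`
    have hMf : ∀ k, |(truncGT (μ : ArithmeticFunction ℝ) (2 ^ k₀ * y) * ζ) k| ≤ (k.divisors.card : ℝ) :=
      fun k => abs_truncGT_moebius_mul_zeta_le _ k
    have hprime := A.abs_S3prime_le hsize hw hx1 (2 ^ k₀) hz0.le hC1 hDcond
      (fun k => (truncGT (μ : ArithmeticFunction ℝ) (2 ^ k₀ * y) * ζ) k) hMf
    have hP1 : ∑ d ∈ (Icc 1 Dn).filter Squarefree, (divisorCountK 5 d : ℝ) *
        ∑ n ∈ Icc 1 ⌊x⌋₊, |A.remainder d n| / n ≤ 2 * R * Real.log x := by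
      have hswap : ∑ d ∈ (Icc 1 Dn).filter Squarefree, (divisorCountK 5 d : ℝ) *
          ∑ n ∈ Icc 1 ⌊x⌋₊, |A.remainder d n| / n =
          ∑ n ∈ Icc 1 ⌊x⌋₊, (1 / (n : ℝ)) * ∑ d ∈ (Icc 1 Dn).filter Squarefree,
            (divisorCountK 5 d : ℝ) * |A.remainder d n| := by
        simp only [Finset.mul_sum]
        rw [Finset.sum_comm]
        refine Finset.sum_congr rfl fun n _ => Finset.sum_congr rfl fun d _ => ?_
        rw [div_eq_mul_one_div]; ring
      rw [hswap]
      calc ∑ n ∈ Icc 1 ⌊x⌋₊, (1 / (n : ℝ)) * ∑ d ∈ (Icc 1 Dn).filter Squarefree,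
            (divisorCountK 5 d : ℝ) * |A.remainder d n|
          ≤ ∑ n ∈ Icc 1 ⌊x⌋₊, (1 / (n : ℝ)) * R := by
            refine Finset.sum_le_sum fun n hn => mul_le_mul_of_nonneg_left (hRx' n ?_)
              (div_nonneg zero_le_one (Nat.cast_nonneg n))
            exact le_trans (by exact_mod_cast (Finset.mem_Icc.mp hn).2) (Nat.floor_le hx0.le)
        _ = (∑ n ∈ Icc 1 ⌊x⌋₊, (1 / (n : ℝ))) * R := by rw [Finset.sum_mul]
        _ ≤ (1 + Real.log X) * R := by
            refine mul_le_mul_of_nonneg_right ?_ hR0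
            have heq : ∑ n ∈ Icc 1 X, (1 : ℝ) / n = (harmonic X : ℝ) := by
              rw [harmonic_eq_sum_Icc]
              push_cast
              exact Finset.sum_congr rfl fun n _ => by rw [one_div]
            rw [heq]
            exact harmonic_le_one_add_log X
        _ ≤ 2 * R * Real.log x := by
            have h := mul_le_mul_of_nonneg_right
              (show 1 + Real.log X ≤ 2 * Real.log x by linarith only [hlogX, hlogx]) hR0
            linarith only [h]
    have hGeq : ∑ d ∈ (Icc 1 Dn).filter Squarefree, ∑ k ∈ d.divisors,
        ((k.divisors.card : ℝ)) ^ 2 *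
          (|A.remainder d (min ((k : ℝ) * z) x)| + |A.remainder d (min ((k : ℝ) * (2 ^ k₀ * z)) x)|) =
        Gf 1 z + Gf (2 ^ k₀) z := by
      rw [hGf]
      dsimp only
      rw [← Finset.sum_add_distrib]
      refine Finset.sum_congr rfl fun d _ => ?_
      rw [← Finset.sum_add_distrib]
      refine Finset.sum_congr rfl fun k _ => ?_
      rw [one_mul, show (k : ℝ) * (2 ^ k₀ * z) = 2 ^ k₀ * ((k : ℝ) * z) by ring]
      ring
    -- `S⁻`: the structural bound, then §10 (`W₀(z) + W₁`)
    have hminus := (abs_S3minus_le_weighted_sum (A := A) hw x y z (2 ^ k₀) C₀).trans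
      ((weighted_T_sum_le h116 hPx1 hLw0 ⌊x⌋₊ z (2 ^ k₀) hC1).trans (add_le_add le_rfl hW1))
    -- combine
    refine h3.trans ?_
    rw [hGeq] at hprime
    have hsum := add_le_add (add_le_add (hstar.trans hstar') (hprime.trans
      (add_le_add hP1 le_rfl))) hminus
    refine hsum.trans (le_of_eq ?_)
    rw [hB₀]; ring
  -- integrate over `z ∈ [Y, eY]`
  have hYe : Y ≤ Real.exp 1 * Y := le_mul_of_one_le_left hY0.le he1
  have hGint : ∀ c, IntervalIntegrable (fun z => Gf c z / z) volume Y (Real.exp 1 * Y) := fun c =>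
    A.intervalIntegrable_boundary_terms hsize x Dn hY0 hYe c
  have hGbound : ∀ c, ∫ z in Y..(Real.exp 1 * Y), Gf c z / z ≤ (1 + Real.log Dn) * R := fun c =>
    A.integral_boundary_terms_le hsize hDn1 hRx' hY0 c
  -- the integrated `W₀`
  obtain ⟨hW0int, hW0le⟩ := integral_W0_le h116 (P x) hx1 k₀ hY0 hLw1 hC1 hB6'
  set gfun : ℝ → ℝ := fun z => B₀ * z⁻¹ + Real.log x * (Gf 1 z / z) + Real.log x * (Gf (2 ^ k₀) z / z) +
    W0f z / z with hgfun
  have hinvint : IntervalIntegrable (fun z : ℝ => B₀ * z⁻¹) volume Y (Real.exp 1 * Y) := by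
    refine (intervalIntegral.intervalIntegrable_inv (fun u hu => ?_) continuousOn_id).const_mul _
    rw [Set.uIcc_of_le hYe] at hu
    exact (hY0.trans_le hu.1).ne'
  have hgint : IntervalIntegrable gfun volume Y (Real.exp 1 * Y) :=
    ((hinvint.add ((hGint 1).const_mul _)).add ((hGint (2 ^ k₀)).const_mul _)).add hW0int
  have hB₀0 : 0 ≤ B₀ :=
    add_nonneg (add_nonneg (div_nonneg (mul_nonneg hKstar0 hA0) hlogx0.le)
      (mul_nonneg (mul_nonneg two_pos.le hR0) hlogx0.le)) hE10
  -- `|∫ S₃ dz/z| ≤ ∫ gfun`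
  obtain ⟨Bd, hBd⟩ := A.exists_bound_fiS2_fiS3 (lam x) x
  have hfint : IntervalIntegrable (fun z => A.fiS3 (lam x) (2 ^ k₀) x y z / z) volume Y (Real.exp 1 * Y) := by
    refine intervalIntegrable_of_abs_le ((A.measurable_fiS3_right (lam x) (2 ^ k₀) x y).div measurable_id)
      (M := Bd / Y) fun z hz => ?_
    rw [Set.uIoc_of_le hYe] at hz
    have hz0 : 0 < z := hY0.trans hz.1
    show |A.fiS3 (lam x) (2 ^ k₀) x y z / z| ≤ Bd / Y
    rw [abs_div, abs_of_pos hz0]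
    calc |A.fiS3 (lam x) (2 ^ k₀) x y z| / z ≤ Bd / z :=
          div_le_div_of_nonneg_right (hBd (2 ^ k₀) y z).2 hz0.le
      _ ≤ Bd / Y := div_le_div_of_nonneg_left (le_trans (abs_nonneg _) (hBd (2 ^ k₀) y z).2) hY0 hz.1.le
  have hnorm : ∀ᵐ z : ℝ, z ∈ Set.Ioc Y (Real.exp 1 * Y) →
      ‖A.fiS3 (lam x) (2 ^ k₀) x y z / z‖ ≤ gfun z := by
    refine Filter.Eventually.of_forall fun z hz => ?_
    have hz0 : 0 < z := hY0.trans hz.1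
    rw [Real.norm_eq_abs, abs_div, abs_of_pos hz0, div_le_iff₀ hz0]
    refine (hptw z hz).trans (le_of_eq ?_)
    rw [hgfun]
    field_simp
    ring
  have hI : |A.fiS3Z (lam x) (2 ^ k₀) x y Y| ≤ ∫ z in Y..(Real.exp 1 * Y), gfun z := by
    have h := intervalIntegral.norm_integral_le_of_norm_le hYe hnorm hgint
    rw [Real.norm_eq_abs] at h
    simpa only [SieveSequence.fiS3Z, SieveSequence.logAvg] using h
  refine hI.trans ?_
  -- evaluate/bound `∫ gfun`
  have hgsplit : ∫ z in Y..(Real.exp 1 * Y), gfun z =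
      B₀ * (∫ z in Y..(Real.exp 1 * Y), z⁻¹) +
        Real.log x * (∫ z in Y..(Real.exp 1 * Y), Gf 1 z / z) +
        Real.log x * (∫ z in Y..(Real.exp 1 * Y), Gf (2 ^ k₀) z / z) +
        ∫ z in Y..(Real.exp 1 * Y), W0f z / z := by
    rw [hgfun, intervalIntegral.integral_add ((hinvint.add ((hGint 1).const_mul _)).add
        ((hGint (2 ^ k₀)).const_mul _)) hW0int,
      intervalIntegral.integral_add (hinvint.add ((hGint 1).const_mul _)) ((hGint (2 ^ k₀)).const_mul _),
      intervalIntegral.integral_add hinvint ((hGint 1).const_mul _),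
      intervalIntegral.integral_const_mul, intervalIntegral.integral_const_mul,
      intervalIntegral.integral_const_mul]
  rw [hgsplit, show (∫ z in Y..(Real.exp 1 * Y), z⁻¹) = 1 from integral_inv_Ioc_exp_mul hY0, mul_one]
  have hlogDn' : (1 + Real.log Dn) * R ≤ 2 * Real.log x * R :=
    mul_le_mul_of_nonneg_right (by linarith only [hlogDn, hlogx]) hR0
  have hG1 := (hGbound 1).trans hlogDn'
  have hG2 := (hGbound (2 ^ k₀)).trans hlogDn'
  -- numerics
  have hlogLw : 1 + Real.log Lw ≤ 2 * Real.log x := by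
    have hLwx : Lw ≤ x := by
      rw [hLw]
      calc x ^ (θ / 2) ≤ x ^ (1 : ℝ) := Real.rpow_le_rpow_of_exponent_le hx1 (by linarith only [hθ, hθ3])
        _ = x := Real.rpow_one x
    have : Real.log Lw ≤ Real.log x := Real.log_le_log hLw0 hLwx
    linarith only [this, hlogx]
  have hlogLw0 : 0 ≤ 1 + Real.log Lw := by
    have : 0 ≤ Real.log Lw := Real.log_nonneg hLw1
    linarith only [this]
  have hW0_le : Real.log C₀ * (k₀ * KBx) * (1 + Real.log Lw) ≤ 16 * KB' * A.size x / Real.log x := by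
    calc Real.log C₀ * (k₀ * KBx) * (1 + Real.log Lw)
        ≤ (2 * Real.log x) * ((4 * Real.log x) * KBx) * (2 * Real.log x) := by
          refine mul_le_mul (mul_le_mul hlogC₀ (mul_le_mul_of_nonneg_right hk₀ hKBx0)
            (mul_nonneg (Nat.cast_nonneg _) hKBx0) (mul_nonneg two_pos.le hlogx0.le)) hlogLw hlogLw0
            (mul_nonneg (mul_nonneg two_pos.le hlogx0.le) (mul_nonneg (by positivity) hKBx0))
      _ = 16 * KB' * A.size x / Real.log x ^ 2 := by rw [hKBx]; field_simp; ring
      _ ≤ 16 * KB' * A.size x / Real.log x := by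
          refine div_le_div_of_nonneg_left (mul_nonneg (mul_nonneg (by norm_num) hKB'0) hA0) hlogx0 ?_
          calc Real.log x = Real.log x ^ 1 := (pow_one _).symm
            _ ≤ Real.log x ^ 2 := pow_le_pow_right₀ hlogx (by norm_num)
  have hE1_le : E1 ≤ 2 * C6 * A.size x / Real.log x := by
    rw [hE1]
    refine div_le_div_of_nonneg_left (mul_nonneg (mul_nonneg two_pos.le hC60) hA0) hlogx0 ?_
    calc Real.log x = Real.log x ^ 1 := (pow_one _).symm
      _ ≤ Real.log x ^ 6 := pow_le_pow_right₀ hlogx (by norm_num)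
  have hRlog : 2 * R * Real.log x ≤ 2 * KR' * A.size x / Real.log x := by
    rw [hRdef]
    have : 2 * (KR' * A.size x / Real.log x ^ 3) * Real.log x = 2 * KR' * A.size x / Real.log x ^ 2 := by
      field_simp
    rw [this]
    refine div_le_div_of_nonneg_left (mul_nonneg (mul_nonneg two_pos.le hKR'0) hA0) hlogx0 ?_
    calc Real.log x = Real.log x ^ 1 := (pow_one _).symm
      _ ≤ Real.log x ^ 2 := pow_le_pow_right₀ hlogx (by norm_num)
  have hRlog2 : Real.log x * (2 * Real.log x * R) = 2 * KR' * A.size x / Real.log x := by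
    rw [hRdef]; field_simp
  calc B₀ + Real.log x * (∫ z in Y..(Real.exp 1 * Y), Gf 1 z / z) +
        Real.log x * (∫ z in Y..(Real.exp 1 * Y), Gf (2 ^ k₀) z / z) +
        ∫ z in Y..(Real.exp 1 * Y), W0f z / z
      ≤ B₀ + Real.log x * (2 * Real.log x * R) + Real.log x * (2 * Real.log x * R) +
          Real.log C₀ * (k₀ * KBx) * (1 + Real.log Lw) := by
        refine add_le_add (add_le_add (add_le_add le_rfl ?_) ?_) hW0le
        · exact mul_le_mul_of_nonneg_left hG1 hlogx0.le
        · exact mul_le_mul_of_nonneg_left hG2 hlogx0.le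
    _ ≤ Kstar * A.size x / Real.log x + 2 * KR' * A.size x / Real.log x +
          2 * C6 * A.size x / Real.log x + 2 * KR' * A.size x / Real.log x +
          2 * KR' * A.size x / Real.log x + 16 * KB' * A.size x / Real.log x := by
        rw [hRlog2, hB₀]
        linarith only [hW0_le, hRlog, hE1_le]
    _ = (Kstar + 16 * KB' + 6 * KR' + 2 * C6) * A.size x / Real.log x := by ring

end Literature.NumberTheory.Sieve
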